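import Summits.BirchSwinnertonDyer.BirchSwinnertonDyer.Theorems.Rank1ResidualJetCarrierNe
import Literature.NumberTheory.EllipticCurves.Rank1Residual.MultiplicativeThreeTowerProofs
import HarnessLib

/-!
# T1 JET (cell `bsd-jet`), bucket A (`q ≠ p`): the register rows' binder shape for the flag-free twin
# `JET.bsdp_of_carrierNeCertificate` — any stated level `N` (Carayol), `p ≥ 5` (Serre) and
# multiplicative `p ∥ N` (Tate line)

HONEST FRAMING (programme file §HONESTY, verbatim): «no tranche here proves BSD; ARM L moves the
LITERAL column of an r ≤ 1 census into the kernel-proved-modulo-named-print column». THEOREMS ONLY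
(seat `bsd-jet-pv-1`; `--supports stmt-BirchSwinnertonDyer-14418`, helper). Sibling of
`Rank1ResidualJetCarrierNe.lean` (§§1–4 there: the reading binder `JET.JetchevDivisibilityCarrierNe`
∘ McCallum Cor. 5.6 ⟹ `Ш(E/ℚ)[p] = 0` ⟹ `BSDp W p`, at level `N = W.conductorNorm ℤ`). This file
re-states the consumer in the binder SHAPE of the register rows and of
`bsdp_of_millerJetchev_of_index_le_tamagawa` ∕ `JET.bsdp_of_jetIndexRow`: a Heegner datum of ANY
stated level `N` (`IsHeegnerPoint N W K P`, `SatisfiesHeegnerHypothesis N K`, `q ∣ N`), with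
`N = N_E` supplied by Carayol's theorem as one more PUBLISHED named binder
(`IsNewformOf.level_eq_conductorNorm`, `hlev`), and with the image input reduced to the register's
galrep datum `ρ̄_{E,p}` onto where a tree THEOREM gives the `p`-adic tower: `p ≥ 5` (Serre IV-23,
`serre_hasSurjectiveModNGaloisRep_pow_holds`) and multiplicative `p ∥ N` at any odd `p`, `p = 3`
included (Tate line, Wuthrich 2014 Lemma 20, `forall_hasSurjectiveModNGaloisRep_pow_of_multiplicative_of_surj`).
Additive-at-`3` bucket-A rows keep the tower as an explicit binder (`bsdp_of_carrierNeCertificate_level`).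
CONDITIONAL on the reading binder `hJ` (audit sheet `HOME/sheets/PV1-A-BLOCK-READING.md`) and every
published binder; nothing is asserted about any curve; PARTITION: row D5 `JET@p∣N` bucket A — 0
classes moved by this file.

References: [Jetchev2008] Thm. 1.4, Cor. 1.5 (p. 812); [McCallumLMS1991] §5 Cor. 5.6;
[DiamondShurman2005] Thm. 8.8.1 (Carayol); [SerreAbelianLadic1968] IV-23 Lemma 3; [Wuthrich2014]
Lemma 20; [Miller2011LMS] Def. 1.1.
-/

noncomputable section

open scoped Classical

open WeierstrassCurve Literature.NumberTheory.EllipticCurves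
  Literature.NumberTheory.EllipticCurves.ModularForms
  Literature.NumberTheory.EllipticCurves.Rank1Residual
  Summit.BirchSwinnertonDyer.Rank1Residual Summit.BirchSwinnertonDyer.Rank1Residual.X11b

namespace Summit.BirchSwinnertonDyer.Rank1Residual.JET

/-! ### §5 General level `N` (the register rows' shape): Carayol's `N = N_E` as one more named binder -/

/-- **`BSD(E,p)` from the bucket-A certificate at a Heegner datum of ANY stated level `N`** — the
binder shape of the register rows (`IsHeegnerPoint N W K P`, `SatisfiesHeegnerHypothesis N K`,
`q ∣ N`, exactly as in `bsdp_of_millerJetchev_of_index_le_tamagawa` and the JET kit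
`JET.bsdp_of_jetIndexRow`): the parametrisation datum inside `IsHeegnerPoint N W K P` carries a
newform of level `N` for `W`, so `N = W.conductorNorm ℤ` by Carayol's theorem (named fact
`IsNewformOf.level_eq_conductorNorm`, `hlev`; Diamond–Shurman Thm. 8.8.1), and §3 applies. The
published binders `hKo`, `hrec`, `hD36` are taken in their `∀ N W K` form. CONDITIONAL on the
reading binder `hJ` and every published binder. [cite: Jetchev2008, Cor. 1.5 (p. 812)]
[cite: DiamondShurman2005, Thm. 8.8.1] [cite: Miller2011LMS, Def. 1.1] -/
theorem bsdp_of_carrierNeCertificate_level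
    (hJ : JetchevDivisibilityCarrierNe)
    (hMcU : McCallum1991_padicValNat_card_sha_primary_add_le_of_globalDivisibility)
    (hGZK : rank_eq_analyticRank_of_analyticRank_le_one)
    (hKo : ∀ (N : ℕ) [NeZero N] (W : WeierstrassCurve ℚ) (K : Type) [Field K] [NumberField K],
      kolyvagin N W K)
    (hrec : ∀ (N : ℕ) [NeZero N] (W : WeierstrassCurve ℚ) (K : Type) [Field K] [NumberField K],
      heegnerPointOfConductor_one_galoisConj N W K)
    (hD36 : ∀ (N : ℕ) [NeZero N] (W : WeierstrassCurve ℚ) (K : Type) [Field K] [NumberField K],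
      phi_heegnerTau_mem_singularModuliField N W K)
    (hlev : ∀ {N : ℕ} [NeZero N], IsNewformOf.level_eq_conductorNorm (N := N))
    (W : WeierstrassCurve ℚ) [W.IsElliptic] [W.IsGloballyMinimal] (p : ℕ) [Fact p.Prime]
    {N : ℕ} [NeZero N] {K : Type} [Field K] [NumberField K] (hK : IsImaginaryQuadratic K)
    (hD3 : NumberField.discr K ≠ -3) (hD4 : NumberField.discr K ≠ -4)
    (hH : SatisfiesHeegnerHypothesis N K) {P : (W.baseChange K).toAffine.Point}
    (hP : IsHeegnerPoint N W K P) (hnt : ¬ IsOfFinAddOrder P)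
    (hp2 : p ≠ 2) (htower : ∀ n : ℕ, W.HasSurjectiveModNGaloisRep (p ^ n : ℕ))
    (q : ℕ) [Fact q.Prime] (hqN : q ∣ N) (hqp : q ≠ p)
    (hI : padicValNat p (AddSubgroup.zmultiples P).index ≤
      padicValNat p ((W.baseChange ℚ_[q]).localTamagawaNumber ℤ_[q]))
    (hr : W.analyticRank ≤ 1) {s : ℚ} (hs : shaAn W = (s : ℂ)) (hv : padicValRat p s = 0) :
    BSDp W p := by
  obtain ⟨Dt, -, -, -⟩ := id hP
  have hN : N = W.conductorNorm ℤ := hlev Dt.isNewformOf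
  subst hN
  exact bsdp_of_carrierNeCertificate hJ hMcU hGZK W K (hKo _ W K) (hrec _ W K) (hD36 _ W K) hK hD3 hD4
    hH p hp2 htower hP hnt q hqN hqp hI hr hs hv

/-- **The same at `p ≥ 5` with the register's galrep datum `ρ̄_{E,p}` onto** (tower by Serre).
CONDITIONAL on the reading binder `hJ` and every published binder.
[cite: Jetchev2008, Cor. 1.5 (p. 812)] [cite: SerreAbelianLadic1968, Ch. IV §3.4 Lemma 3 (IV-23)]
[cite: DiamondShurman2005, Thm. 8.8.1] -/
theorem bsdp_of_carrierNeCertificate_level_of_five_le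
    (hJ : JetchevDivisibilityCarrierNe)
    (hMcU : McCallum1991_padicValNat_card_sha_primary_add_le_of_globalDivisibility)
    (hGZK : rank_eq_analyticRank_of_analyticRank_le_one)
    (hKo : ∀ (N : ℕ) [NeZero N] (W : WeierstrassCurve ℚ) (K : Type) [Field K] [NumberField K],
      kolyvagin N W K)
    (hrec : ∀ (N : ℕ) [NeZero N] (W : WeierstrassCurve ℚ) (K : Type) [Field K] [NumberField K],
      heegnerPointOfConductor_one_galoisConj N W K)
    (hD36 : ∀ (N : ℕ) [NeZero N] (W : WeierstrassCurve ℚ) (K : Type) [Field K] [NumberField K],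
      phi_heegnerTau_mem_singularModuliField N W K)
    (hlev : ∀ {N : ℕ} [NeZero N], IsNewformOf.level_eq_conductorNorm (N := N))
    (W : WeierstrassCurve ℚ) [W.IsElliptic] [W.IsGloballyMinimal] (p : ℕ) [Fact p.Prime]
    {N : ℕ} [NeZero N] {K : Type} [Field K] [NumberField K] (hK : IsImaginaryQuadratic K)
    (hD3 : NumberField.discr K ≠ -3) (hD4 : NumberField.discr K ≠ -4)
    (hH : SatisfiesHeegnerHypothesis N K) {P : (W.baseChange K).toAffine.Point}
    (hP : IsHeegnerPoint N W K P) (hnt : ¬ IsOfFinAddOrder P)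
    (h5 : 5 ≤ p) (hsurj : W.HasSurjectiveModNGaloisRep p)
    (q : ℕ) [Fact q.Prime] (hqN : q ∣ N) (hqp : q ≠ p)
    (hI : padicValNat p (AddSubgroup.zmultiples P).index ≤
      padicValNat p ((W.baseChange ℚ_[q]).localTamagawaNumber ℤ_[q]))
    (hr : W.analyticRank ≤ 1) {s : ℚ} (hs : shaAn W = (s : ℂ)) (hv : padicValRat p s = 0) :
    BSDp W p :=
  bsdp_of_carrierNeCertificate_level hJ hMcU hGZK hKo hrec hD36 hlev W p hK hD3 hD4 hH hP hnt
    (by omega) (serre_hasSurjectiveModNGaloisRep_pow_holds W p h5 hsurj) q hqN hqp hI hr hs hv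

/-! ### §6 Multiplicative `p` (every odd `p`, the `p ∥ N` rows of bucket A incl. `p = 3`): the tower from `ρ̄_{E,p}` onto and the Tate line -/

/-- **`BSD(E,p)` from the bucket-A certificate at a MULTIPLICATIVE `p ∥ N`, any odd `p` (so also
`p = 3`), with `ρ̄_{E,p}` onto as the only image input**: at a multiplicative prime the `p`-adic tower
follows from mod-`p` surjectivity via the Tate line (Wuthrich 2014 Lemma 20 ∕ Serre IV A.1; tree
THEOREM `WeierstrassCurve.forall_hasSurjectiveModNGaloisRep_pow_of_multiplicative_of_surj`). Level-`N`
row shape as in §5. CONDITIONAL on the reading binder `hJ` and every published binder.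
[cite: Jetchev2008, Cor. 1.5 (p. 812)] [cite: Wuthrich2014, Lemma 20 (p. 399)]
[cite: DiamondShurman2005, Thm. 8.8.1] [cite: Miller2011LMS, Def. 1.1] -/
theorem bsdp_of_carrierNeCertificate_level_of_mult
    (hJ : JetchevDivisibilityCarrierNe)
    (hMcU : McCallum1991_padicValNat_card_sha_primary_add_le_of_globalDivisibility)
    (hGZK : rank_eq_analyticRank_of_analyticRank_le_one)
    (hKo : ∀ (N : ℕ) [NeZero N] (W : WeierstrassCurve ℚ) (K : Type) [Field K] [NumberField K],
      kolyvagin N W K)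
    (hrec : ∀ (N : ℕ) [NeZero N] (W : WeierstrassCurve ℚ) (K : Type) [Field K] [NumberField K],
      heegnerPointOfConductor_one_galoisConj N W K)
    (hD36 : ∀ (N : ℕ) [NeZero N] (W : WeierstrassCurve ℚ) (K : Type) [Field K] [NumberField K],
      phi_heegnerTau_mem_singularModuliField N W K)
    (hlev : ∀ {N : ℕ} [NeZero N], IsNewformOf.level_eq_conductorNorm (N := N))
    (W : WeierstrassCurve ℚ) [W.IsElliptic] [W.IsGloballyMinimal] (p : ℕ) [Fact p.Prime]
    {N : ℕ} [NeZero N] {K : Type} [Field K] [NumberField K] (hK : IsImaginaryQuadratic K)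
    (hD3 : NumberField.discr K ≠ -3) (hD4 : NumberField.discr K ≠ -4)
    (hH : SatisfiesHeegnerHypothesis N K) {P : (W.baseChange K).toAffine.Point}
    (hP : IsHeegnerPoint N W K P) (hnt : ¬ IsOfFinAddOrder P)
    (hp2 : p ≠ 2) (hmult : W.HasMultiplicativeReductionAtPrime p)
    (hsurj : W.HasSurjectiveModNGaloisRep p)
    (q : ℕ) [Fact q.Prime] (hqN : q ∣ N) (hqp : q ≠ p)
    (hI : padicValNat p (AddSubgroup.zmultiples P).index ≤
      padicValNat p ((W.baseChange ℚ_[q]).localTamagawaNumber ℤ_[q]))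
    (hr : W.analyticRank ≤ 1) {s : ℚ} (hs : shaAn W = (s : ℂ)) (hv : padicValRat p s = 0) :
    BSDp W p :=
  bsdp_of_carrierNeCertificate_level hJ hMcU hGZK hKo hrec hD36 hlev W p hK hD3 hD4 hH hP hnt hp2
    (W.forall_hasSurjectiveModNGaloisRep_pow_of_multiplicative_of_surj p hp2 hmult hsurj) q hqN hqp hI
    hr hs hv

end Summit.BirchSwinnertonDyer.Rank1Residual.JET

end
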